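import Summits.ValiantsHypothesis.ValiantsHypothesis.Theses.ValuativeGCT

/-!
# `ValuativeGCT.CutBites` (stmt-ValiantsHypothesis-12626), line adjugate-pfaffian-kernel — Stub 1 `stub_detStab_isUnit`

The cofactor chain rule forces invertibility.  If `M · vec (cof (T_M Y)) = vec (cof Y)` holds identically in the
generic `m × m` matrix `Y` over `MvPolynomial (MatIdx m) ℂ` (`T_M Y = mat (Mᵀ vec Y)`, `cof Z = Z.adjugateᵀ`), then
`M : Matrix (MatIdx m) (MatIdx m) ℂ` is a unit.  Proof: specialising the polynomial identity at a complex matrix `y`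
(`MvPolynomial.eval`, `RingHom.map_adjugate`) shows that `vec (cof y)` lies in the range of `M.mulVec` for every
`y`; the cofactor matrices of `1` (namely `1`), of the transvections `1 + E_ba` for `a ≠ b` (namely `1 - E_ab`) and of
the diagonal matrices `1 - E_aa` (namely `E_aa`) span `ℂ^{MatIdx m}`, so `M.mulVec` is onto and
`Matrix.mulVec_surjective_iff_isUnit` concludes.  The degenerate sizes `m = 0, 1` need no separate treatment (for
`m = 1` only the diagonal case occurs).  Used in `CutBites_of` to turn Stub 2's chain rule into the invertibility that
Stub 3 consumes (Marcus–Moyls 1959, Lemma 7, is the classical form of the statement). [folklore]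
-/

namespace Summit.ValiantsHypothesis.ValiantsHypothesis.Theorems.CutBitesAdjugate

open Literature.NumberTheory.DiophantineGeometry Literature.Computability.AlgebraicComplexity
open MvPolynomial
open scoped BigOperators Matrix

-- `Summit.ValiantsHypothesis.ValiantsHypothesis.…` is the tree's mandated single-conjunct layout (Sub = Summit).
set_option linter.dupNamespace false

/-- The adjugate of a transvection `1 + c • E_ij` (`i ≠ j`) is the opposite transvection `1 - c • E_ij`: the
transvection has determinant `1`, so its adjugate is its inverse. [folklore] -/
theorem cbAdj_adjugate_transvection {n : Type*} [Fintype n] [DecidableEq n] {R : Type*} [CommRing R]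
    {i j : n} (hij : i ≠ j) (c : R) :
    (Matrix.transvection i j c).adjugate = Matrix.transvection i j (-c) := by
  have hdet : (Matrix.transvection i j c).det = 1 := Matrix.det_transvection_of_ne i j hij c
  have hinv : (Matrix.transvection i j c)⁻¹ = Matrix.transvection i j (-c) :=
    Matrix.inv_eq_left_inv (by
      rw [Matrix.transvection_mul_transvection_same i j hij, neg_add_cancel, Matrix.transvection_zero])
  rw [← hinv, Matrix.inv_def, hdet, Ring.inverse_one, one_smul]

/-- For the `0/1`-vector vanishing exactly at `a`, the product over all indices `≠ i` is `1` if `i = a` and `0`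
otherwise. [folklore] -/
theorem cbAdj_prod_erase_ite {n : Type*} [Fintype n] [DecidableEq n] {R : Type*} [CommRing R] (a i : n) :
    (∏ j ∈ Finset.univ.erase i, (if j = a then (0 : R) else 1)) = if i = a then 1 else 0 := by
  by_cases hi : i = a
  · rw [if_pos hi]
    refine Finset.prod_eq_one fun j hj => ?_
    rw [if_neg (hi ▸ Finset.ne_of_mem_erase hj)]
  · rw [if_neg hi]
    exact Finset.prod_eq_zero (Finset.mem_erase.mpr ⟨Ne.symm hi, Finset.mem_univ a⟩) (if_pos rfl)

/-- For `a ≠ b` in `Fin m`: reading cofactor matrices as vectors indexed by `MatIdx m`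
(`l ↦ (adjugate y) (ofLex l).2 (ofLex l).1 = (cof y) (ofLex l).1 (ofLex l).2`), one has
`vec (cof 1) - vec (cof (1 + E_ba)) = e_{(a,b)}`. [folklore] -/
theorem cbAdj_vec_transvection {m : ℕ} {R : Type*} [CommRing R] {a b : Fin m} (hab : a ≠ b) :
    ((fun l : MatIdx m => (1 : Matrix (Fin m) (Fin m) R).adjugate (ofLex l).2 (ofLex l).1) -
      fun l : MatIdx m => (Matrix.transvection b a (1 : R)).adjugate (ofLex l).2 (ofLex l).1)
      = Pi.single (toLex (a, b)) 1 := by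
  rw [Matrix.adjugate_one, cbAdj_adjugate_transvection (Ne.symm hab)]
  funext l
  obtain ⟨⟨c, d⟩, rfl⟩ : ∃ p : Fin m × Fin m, toLex p = l := ⟨ofLex l, rfl⟩
  simp only [Pi.sub_apply, ofLex_toLex, Matrix.transvection, Matrix.add_apply, Matrix.one_apply,
    Matrix.single_apply, Pi.single_apply, toLex_inj, Prod.mk.injEq, sub_add_cancel_left]
  by_cases hc : c = a
  · subst hc
    by_cases hd : d = b
    · subst hd
      simp
    · simp [hd, Ne.symm hd]
  · simp [hc, Ne.symm hc]

/-- For `a` in `Fin m`: the cofactor matrix of the diagonal matrix `1 - E_aa`, read as a vector indexed by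
`MatIdx m`, is `e_{(a,a)}`. [folklore] -/
theorem cbAdj_vec_diagonal {m : ℕ} {R : Type*} [CommRing R] (a : Fin m) :
    (fun l : MatIdx m => (Matrix.diagonal fun j : Fin m => if j = a then (0 : R) else 1).adjugate
        (ofLex l).2 (ofLex l).1) = Pi.single (toLex (a, a)) 1 := by
  rw [Matrix.adjugate_diagonal]
  funext l
  obtain ⟨⟨c, d⟩, rfl⟩ : ∃ p : Fin m × Fin m, toLex p = l := ⟨ofLex l, rfl⟩
  simp only [cbAdj_prod_erase_ite, ofLex_toLex, Matrix.diagonal_apply, Pi.single_apply, toLex_inj,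
    Prod.mk.injEq]
  by_cases hd : d = a
  · subst hd
    by_cases hdc : d = c
    · subst hdc
      simp
    · simp [hdc, Ne.symm hdc]
  · simp [hd]

/-- **Specialisation of the cofactor chain rule.**  If `M · vec (cof (T_M Y)) = vec (cof Y)` identically in the
generic matrix `Y`, then for every complex matrix `y` the vector `vec (cof y)` lies in the range of `M.mulVec`
(evaluate the identity at `y`; `RingHom.map_adjugate`). [folklore] -/
theorem cbAdj_vec_cof_mem_range {m : ℕ} (M : Matrix (MatIdx m) (MatIdx m) ℂ)
    (hC : (Matrix.of fun a b : Fin m => ∑ l : MatIdx m, M (toLex (a, b)) l •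
        (Matrix.of fun a' b' : Fin m => ∑ l' : MatIdx m, M l' (toLex (a', b')) •
          (X l' : MvPolynomial (MatIdx m) ℂ)).adjugateᵀ (ofLex l).1 (ofLex l).2)
      = (Matrix.of fun a b : Fin m => (X (toLex (a, b)) : MvPolynomial (MatIdx m) ℂ)).adjugateᵀ)
    (y : Matrix (Fin m) (Fin m) ℂ) :
    (fun l : MatIdx m => y.adjugate (ofLex l).2 (ofLex l).1) ∈ LinearMap.range (Matrix.mulVecLin M) := by
  refine ⟨fun l : MatIdx m => (Matrix.of fun a' b' : Fin m =>
      ∑ l' : MatIdx m, M l' (toLex (a', b')) * y (ofLex l').1 (ofLex l').2).adjugate (ofLex l).2 (ofLex l).1, ?_⟩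
  funext l
  obtain ⟨⟨a, b⟩, rfl⟩ : ∃ p : Fin m × Fin m, toLex p = l := ⟨ofLex l, rfl⟩
  have hadj : ∀ (N : Matrix (Fin m) (Fin m) (MvPolynomial (MatIdx m) ℂ)) (i j : Fin m),
      MvPolynomial.eval (fun l : MatIdx m => y (ofLex l).1 (ofLex l).2) (N.adjugate i j)
        = (N.map (MvPolynomial.eval fun l : MatIdx m => y (ofLex l).1 (ofLex l).2)).adjugate i j := by
    intro N i j
    have h := RingHom.map_adjugate (MvPolynomial.eval fun l : MatIdx m => y (ofLex l).1 (ofLex l).2) N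
    rw [RingHom.mapMatrix_apply, RingHom.mapMatrix_apply] at h
    exact congrFun (congrFun h i) j
  have hG : (Matrix.of fun a b : Fin m => (X (toLex (a, b)) : MvPolynomial (MatIdx m) ℂ)).map
      (MvPolynomial.eval fun l : MatIdx m => y (ofLex l).1 (ofLex l).2) = y := by
    ext i j
    simp
  have hT : (Matrix.of fun a' b' : Fin m => ∑ l' : MatIdx m, M l' (toLex (a', b')) •
      (X l' : MvPolynomial (MatIdx m) ℂ)).map (MvPolynomial.eval fun l : MatIdx m => y (ofLex l).1 (ofLex l).2)
      = Matrix.of fun a' b' : Fin m =>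
          ∑ l' : MatIdx m, M l' (toLex (a', b')) * y (ofLex l').1 (ofLex l').2 := by
    ext i j
    simp [smul_eval]
  have h := congrArg (MvPolynomial.eval fun l : MatIdx m => y (ofLex l).1 (ofLex l).2)
    (congrFun (congrFun hC a) b)
  simp only [Matrix.of_apply, Matrix.transpose_apply, map_sum, smul_eval, hadj, hG, hT] at h
  simpa [Matrix.mulVecLin_apply, Matrix.mulVec, dotProduct] using h

/-- **Stub 1 — the cofactor chain rule forces invertibility.**  If `M · vec (cof (T_M Y)) = vec (cof Y)`
identically in the generic matrix `Y` (`T_M Y = mat (Mᵀ vec Y)`, `cof Z = Z.adjugateᵀ`), then `M` is a unit: by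
`cbAdj_vec_cof_mem_range` every `vec (cof y)` is in the range of `M.mulVec`; the cofactor vectors of `1`, `1 + E_ba`
(`a ≠ b`) and `1 - E_aa` give every `e_{(a,b)}` (`cbAdj_vec_transvection`, `cbAdj_vec_diagonal`), so `M.mulVec` is
onto and `Matrix.mulVec_surjective_iff_isUnit` applies.  `m = 0, 1` are covered by the same argument. [folklore] -/
theorem stub_detStab_isUnit (m : ℕ) (M : Matrix (MatIdx m) (MatIdx m) ℂ)
    (hC : (Matrix.of fun a b : Fin m => ∑ l : MatIdx m, M (toLex (a, b)) l •
        (Matrix.of fun a' b' : Fin m => ∑ l' : MatIdx m, M l' (toLex (a', b')) •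
          (X l' : MvPolynomial (MatIdx m) ℂ)).adjugateᵀ (ofLex l).1 (ofLex l).2)
      = (Matrix.of fun a b : Fin m => (X (toLex (a, b)) : MvPolynomial (MatIdx m) ℂ)).adjugateᵀ) :
    IsUnit M := by
  rw [← Matrix.mulVec_surjective_iff_isUnit]
  have key : ∀ (l : MatIdx m) (c : ℂ), Pi.single l c ∈ LinearMap.range (Matrix.mulVecLin M) := by
    intro l c
    have h1 : Pi.single l (1 : ℂ) ∈ LinearMap.range (Matrix.mulVecLin M) := by
      obtain ⟨⟨a, b⟩, rfl⟩ : ∃ p : Fin m × Fin m, toLex p = l := ⟨ofLex l, rfl⟩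
      rcases eq_or_ne a b with rfl | hab
      · rw [← cbAdj_vec_diagonal (R := ℂ) a]
        exact cbAdj_vec_cof_mem_range M hC _
      · rw [← cbAdj_vec_transvection (R := ℂ) hab]
        exact Submodule.sub_mem _ (cbAdj_vec_cof_mem_range M hC _) (cbAdj_vec_cof_mem_range M hC _)
    have hc : Pi.single l c = c • Pi.single l (1 : ℂ) := by
      rw [← Pi.single_smul', smul_eq_mul, mul_one]
    rw [hc]
    exact Submodule.smul_mem _ c h1
  intro x
  obtain ⟨v, hv⟩ : x ∈ LinearMap.range (Matrix.mulVecLin M) :=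
    Pi.single_induction (fun x => x ∈ LinearMap.range (Matrix.mulVecLin M)) x (Submodule.zero_mem _)
      (fun f g hf hg => Submodule.add_mem _ hf hg) key
  exact ⟨v, by simpa [Matrix.mulVecLin_apply] using hv⟩

end Summit.ValiantsHypothesis.ValiantsHypothesis.Theorems.CutBitesAdjugate
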